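import Mathlib
import Summits.ValiantsHypothesis.ValiantsHypothesis.Theorems.KPlusLogSqLawStepSupStructure

/-!
# The CONTINUATION LAW: a step away from the natural side of its row is terminal
# (static path model behind `KPlusLogSqLaw.TropicalB`)

Cell pub-symmetroid, seat conjb-2 (g21). A helper toward the crux `TropicalB`
(`Summit.ValiantsHypothesis.ValiantsHypothesis.Theses.KPlusLogSqLaw.TropicalB`, item
`stmt-ValiantsHypothesis-19771`); it earns no crux credit and is not evidence for `MatrixDescartes` or for
Valiant's hypothesis.

Lines `S t θ = b t + s t * θ`; windows separated when the even-indexed lines lie strictly above the odd-indexed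
ones; a *step* at row `i` (reach `d`): `[i, i+d]` separated somewhere, `[i+1, i+d+1]` separated somewhere, never
both (THEORY-NOTE-g21 §3). The NATURAL SIDE of row `i` is the side on which the comparison of the lines `i` and
`i+1` bounds every window starting at `i`: the left when `S i - S (i+1)` is increasing (for even `i`: `s (i+1) < s i`,
i.e. `λ_i > 0` in the two-speed walk), the right otherwise.

THEOREM (CONTINUATION LAW, THEORY-NOTE-g21 §3.1ter; located beforehand: in every realisable plateau word of the
cell's tables — reach 3: 116 + 16 words with 2 and 3 steps, reach 5: 1 854 + 268, reach 7: 2 396 two-step words — a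
step followed by another step moves toward the natural side of its row, 100 %). If the step at row `i` (odd reach
`d`) moves AWAY from the natural side of row `i` — the separation set of `[i+1, i+d+1]` lies on the far side of that
of `[i, i+d]` — then row `i+1` does not step: if `[i+2, i+d+2]` is separated somewhere, then `[i+1, i+d+1]` and
`[i+2, i+d+2]` are separated simultaneously somewhere (so `J(i+2) = J(i+1)` in the reach profile). With
`KPlusLogSqLawReachThreeStep.reach3_step_forces` (S3: a bad reach-3 row steps away from its natural side) it recovers
LEMMA F2 (`KPlusLogSqLawReachThreeNoSecondStep`); here the reach is arbitrary and the only slope hypothesis is the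
direction of the step.

* `away_step_terminal_core` — the argument, for an arbitrary class `up` of upper lines (line `i` upper, `i+1` not):
  by `KPlusLogSqLawStepSupStructure.step_sup_structure` at `r = sup T[i, i+d]` some non-upper inner line `o` meets the
  line `i`, with `s i < s o`, and `S (i+1) ≤ S i` at `r`; hence `S (i+1) < S o` strictly to the right of `r`, where all
  separation points of `[i+1, i+d+1]` lie. A second step at row `i+1` has (by the same structure theorem applied to
  row `i+1`, whose outer lines are non-upper, on the negated lines and, if it moves left, on `θ ↦ -θ`) a point `ρ`
  with `T[i+1, i+d+1]` on one side, where the line `i+1` meets an upper line and lies above every non-upper line of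
  `[i+1, i+d+1]`, in particular above `o`; `ρ > r` contradicts the strict inequality, and `ρ = r` forces the lines
  `i`, `i+1` to meet at `r`, which empties `T[i, i+d]` (it lies left of `r` and needs `S (i+1) < S i`).
* `away_step_terminal_even` (`i` even, `s (i+1) < s i`, step moving right) and `away_step_terminal_odd` (`i` odd,
  `s i < s (i+1)`, step moving right); the mirror images (steps moving left away from a right natural side) are in
  `KPlusLogSqLawStepTerminalMirror`.
-/

set_option linter.dupNamespace false

namespace Summit.ValiantsHypothesis.ValiantsHypothesis.Theorems.KPlusLogSqLawStepTerminal

open Summit.ValiantsHypothesis.ValiantsHypothesis.Theorems.KPlusLogSqLawStepSupStructure (step_sup_structure)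
open Summit.ValiantsHypothesis.ValiantsHypothesis.Theorems.KPlusLogSqLawStepSlopes (step_slopes_even step_slopes_odd)

/-- CONTINUATION LAW, core (class `up` of upper lines; `i`, `i+d+1` upper, `i+1`, `i+d+2` not; natural side of row
`i` on the left: `s (i+1) < s i`; the step at row `i` moves right). A step at row `i+1`, in either direction, is
contradictory. -/
theorem away_step_terminal_core (up : ℕ → Prop) (s b : ℕ → ℝ) (i d : ℕ) (hup0 : up i) (hlow1 : ¬ up (i + 1))
    (hup1 : up (i + d + 1)) (hlow2 : ¬ up (i + d + 2)) (hd : 1 ≤ d) (hnat : s (i + 1) < s i)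
    (hA : ∃ θ : ℝ, ∀ e o : ℕ, i ≤ e → e ≤ i + d → i ≤ o → o ≤ i + d → up e → ¬ up o →
      b o + s o * θ < b e + s e * θ)
    (hB : ∃ θ : ℝ, ∀ e o : ℕ, i + 1 ≤ e → e ≤ i + d + 1 → i + 1 ≤ o → o ≤ i + d + 1 → up e → ¬ up o →
      b o + s o * θ < b e + s e * θ)
    (hAB : ∀ θ : ℝ, ¬ ((∀ e o : ℕ, i ≤ e → e ≤ i + d → i ≤ o → o ≤ i + d → up e → ¬ up o →
      b o + s o * θ < b e + s e * θ) ∧ (∀ e o : ℕ, i + 1 ≤ e → e ≤ i + d + 1 → i + 1 ≤ o → o ≤ i + d + 1 →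
      up e → ¬ up o → b o + s o * θ < b e + s e * θ)))
    (hord : ∀ θ θ' : ℝ, (∀ e o : ℕ, i ≤ e → e ≤ i + d → i ≤ o → o ≤ i + d → up e → ¬ up o →
      b o + s o * θ < b e + s e * θ) → (∀ e o : ℕ, i + 1 ≤ e → e ≤ i + d + 1 → i + 1 ≤ o → o ≤ i + d + 1 →
      up e → ¬ up o → b o + s o * θ' < b e + s e * θ') → θ < θ')
    (hB' : ∃ θ : ℝ, ∀ e o : ℕ, i + 2 ≤ e → e ≤ i + d + 2 → i + 2 ≤ o → o ≤ i + d + 2 → up e → ¬ up o →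
      b o + s o * θ < b e + s e * θ)
    (hBB' : ∀ θ : ℝ, ¬ ((∀ e o : ℕ, i + 1 ≤ e → e ≤ i + d + 1 → i + 1 ≤ o → o ≤ i + d + 1 → up e → ¬ up o →
      b o + s o * θ < b e + s e * θ) ∧ (∀ e o : ℕ, i + 2 ≤ e → e ≤ i + d + 2 → i + 2 ≤ o → o ≤ i + d + 2 →
      up e → ¬ up o → b o + s o * θ < b e + s e * θ)))
    (hdich : (∀ θ θ' : ℝ, (∀ e o : ℕ, i + 1 ≤ e → e ≤ i + d + 1 → i + 1 ≤ o → o ≤ i + d + 1 → up e → ¬ up o →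
      b o + s o * θ < b e + s e * θ) → (∀ e o : ℕ, i + 2 ≤ e → e ≤ i + d + 2 → i + 2 ≤ o → o ≤ i + d + 2 →
      up e → ¬ up o → b o + s o * θ' < b e + s e * θ') → θ < θ') ∨
      (∀ θ θ' : ℝ, (∀ e o : ℕ, i + 1 ≤ e → e ≤ i + d + 1 → i + 1 ≤ o → o ≤ i + d + 1 → up e → ¬ up o →
      b o + s o * θ < b e + s e * θ) → (∀ e o : ℕ, i + 2 ≤ e → e ≤ i + d + 2 → i + 2 ≤ o → o ≤ i + d + 2 →
      up e → ¬ up o → b o + s o * θ' < b e + s e * θ') → θ' < θ)) : False := by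
  classical
  obtain ⟨θA, hθA⟩ := hA
  obtain ⟨θB, hθB⟩ := hB
  obtain ⟨θB', hθB'⟩ := hB'
  -- fine structure of the step at row `i`
  obtain ⟨r, o, ho1, ho2, hou, hso, -, hoeq, hcmp, hTle, -, hBgt⟩ :=
    step_sup_structure up s b i d hup0 hup1 ⟨i + 1, le_refl _, by omega, hlow1⟩ ⟨θA, hθA⟩ ⟨θB, hθB⟩ hAB hord
  have hi1 : b (i + 1) + s (i + 1) * r ≤ b i + s i * r :=
    hcmp i (i + 1) (le_refl _) (by omega) (by omega) (by omega) hup0 hlow1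
  -- to the right of `r` the line `i+1` is strictly below the line `o`
  have key : ∀ θ : ℝ, r < θ → b (i + 1) + s (i + 1) * θ < b o + s o * θ := by
    intro θ hθ
    have p : 0 < (s o - s (i + 1)) * (θ - r) := mul_pos (by linarith) (by linarith)
    have i1 : (b o + s o * θ) - (b (i + 1) + s (i + 1) * θ)
        = ((b o + s o * r) - (b (i + 1) + s (i + 1) * r)) + (s o - s (i + 1)) * (θ - r) := by ring
    linarith
  -- if the lines `i`, `i+1` met at `r`, `T[i, i+d]` (which lies left of `r`) would be empty
  have noteq : b o + s o * r ≤ b (i + 1) + s (i + 1) * r → False := by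
    intro hle
    have heq : b (i + 1) + s (i + 1) * r = b i + s i * r := by linarith
    have hθAle : θA ≤ r := hTle θA hθA
    have dA := hθA i (i + 1) (le_refl _) (by omega) (by omega) (by omega) hup0 hlow1
    have p : 0 ≤ (s i - s (i + 1)) * (r - θA) := mul_nonneg (by linarith) (by linarith)
    have i1 : (b i + s i * θA) - (b (i + 1) + s (i + 1) * θA)
        = ((b i + s i * r) - (b (i + 1) + s (i + 1) * r)) - (s i - s (i + 1)) * (r - θA) := by ring
    linarith
  have hrB : r < θB := hBgt θB hθB
  -- the non-upper class, for the analysis of row `i+1` (outer lines `i+1`, `i+d+2` non-upper)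
  have hlow' : ∃ x : ℕ, i + 1 + 1 ≤ x ∧ x ≤ i + 1 + d ∧ ¬ (¬ up x) :=
    ⟨i + d + 1, by omega, by omega, fun h => h hup1⟩
  have hlow2' : ¬ up (i + 1 + d + 1) := by
    rw [show i + 1 + d + 1 = i + d + 2 by omega]
    exact hlow2
  rcases hdich with hL | hR
  · -- `T[i+1, i+d+1]` left of `T[i+2, i+d+2]`: structure theorem for row `i+1` on the negated lines
    obtain ⟨r₁, x, hx1, hx2, hxu, -, -, hxeq, hcmp₁, hTle₁, -, -⟩ :=
      step_sup_structure (fun n => ¬ up n) (fun t => - s t) (fun t => - b t) (i + 1) d hlow1 hlow2' hlow'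
        ⟨θB, fun e o' h1 h2 h3 h4 he ho' => by
          have := hθB o' e h3 (by omega) h1 (by omega) (not_not.mp ho') he
          linarith⟩
        ⟨θB', fun e o' h1 h2 h3 h4 he ho' => by
          have := hθB' o' e (by omega) (by omega) (by omega) (by omega) (not_not.mp ho') he
          linarith⟩
        (fun θ hθ => hBB' θ
          ⟨fun e o' h1 h2 h3 h4 he ho' => by
            have := hθ.1 o' e h3 (by omega) h1 (by omega) ho' (not_not.mpr he)
            linarith,
           fun e o' h1 h2 h3 h4 he ho' => by
            have := hθ.2 o' e (by omega) (by omega) (by omega) (by omega) ho' (not_not.mpr he)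
            linarith⟩)
        (fun θ θ' hθ hθ' => hL θ θ'
          (fun e o' h1 h2 h3 h4 he ho' => by
            have := hθ o' e h3 (by omega) h1 (by omega) ho' (not_not.mpr he)
            linarith)
          (fun e o' h1 h2 h3 h4 he ho' => by
            have := hθ' o' e (by omega) (by omega) (by omega) (by omega) ho' (not_not.mpr he)
            linarith))
    -- at `r₁ > r` the line `i+1` meets the upper line `x`, which lies above `o`
    have hox : (- b x) + (- s x) * r₁ ≤ (- b o) + (- s o) * r₁ :=
      hcmp₁ o x ho1 (by omega) (by omega) hx2 hou hxu
    have h1 : r < r₁ := lt_of_lt_of_le hrB (hTle₁ θB (fun e o' g1 g2 g3 g4 he ho' => by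
      have := hθB o' e g3 (by omega) g1 (by omega) (not_not.mp ho') he
      linarith))
    have h2 := key r₁ h1
    linarith
  · -- `T[i+2, i+d+2]` left of `T[i+1, i+d+1]`: structure theorem for row `i+1` on the negated lines, `θ ↦ -θ`
    obtain ⟨ρ', x, hx1, hx2, hxu, -, -, hxeq, hcmp₁, -, happ₁, -⟩ :=
      step_sup_structure (fun n => ¬ up n) s (fun t => - b t) (i + 1) d hlow1 hlow2' hlow'
        ⟨-θB, fun e o' h1 h2 h3 h4 he ho' => by
          have := hθB o' e h3 (by omega) h1 (by omega) (not_not.mp ho') he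
          have r1 : s o' * (-θB) = -(s o' * θB) := by ring
          have r2 : s e * (-θB) = -(s e * θB) := by ring
          linarith⟩
        ⟨-θB', fun e o' h1 h2 h3 h4 he ho' => by
          have := hθB' o' e (by omega) (by omega) (by omega) (by omega) (not_not.mp ho') he
          have r1 : s o' * (-θB') = -(s o' * θB') := by ring
          have r2 : s e * (-θB') = -(s e * θB') := by ring
          linarith⟩
        (fun θ hθ => hBB' (-θ)
          ⟨fun e o' h1 h2 h3 h4 he ho' => by
            have := hθ.1 o' e h3 (by omega) h1 (by omega) ho' (not_not.mpr he)
            have r1 : s o' * (-θ) = -(s o' * θ) := by ring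
            have r2 : s e * (-θ) = -(s e * θ) := by ring
            linarith,
           fun e o' h1 h2 h3 h4 he ho' => by
            have := hθ.2 o' e (by omega) (by omega) (by omega) (by omega) ho' (not_not.mpr he)
            have r1 : s o' * (-θ) = -(s o' * θ) := by ring
            have r2 : s e * (-θ) = -(s e * θ) := by ring
            linarith⟩)
        (fun θ θ' hθ hθ' => by
          have := hR (-θ) (-θ')
            (fun e o' h1 h2 h3 h4 he ho' => by
              have := hθ o' e h3 (by omega) h1 (by omega) ho' (not_not.mpr he)
              have r1 : s o' * (-θ) = -(s o' * θ) := by ring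
              have r2 : s e * (-θ) = -(s e * θ) := by ring
              linarith)
            (fun e o' h1 h2 h3 h4 he ho' => by
              have := hθ' o' e (by omega) (by omega) (by omega) (by omega) ho' (not_not.mpr he)
              have r1 : s o' * (-θ') = -(s o' * θ') := by ring
              have r2 : s e * (-θ') = -(s e * θ') := by ring
              linarith)
          linarith)
    -- the point `ρ = -ρ'` is at least `r`: `T[i+1, i+d+1]` has points below `ρ + ε`, all of them `> r`
    have hox : (- b x) + s x * ρ' ≤ (- b o) + s o * ρ' :=
      hcmp₁ o x ho1 (by omega) (by omega) hx2 hou hxu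
    have hle : r ≤ -ρ' := by
      by_contra hcon
      have hlt : -ρ' < r := lt_of_not_ge hcon
      obtain ⟨θ, hθ, hθlt⟩ := happ₁ (ρ' + r) (by linarith)
      have hsep : ∀ e o' : ℕ, i + 1 ≤ e → e ≤ i + d + 1 → i + 1 ≤ o' → o' ≤ i + d + 1 → up e → ¬ up o' →
          b o' + s o' * (-θ) < b e + s e * (-θ) := by
        intro e o' h1 h2 h3 h4 he ho'
        have := hθ o' e h3 (by omega) h1 (by omega) ho' (not_not.mpr he)
        have r1 : s o' * (-θ) = -(s o' * θ) := by ring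
        have r2 : s e * (-θ) = -(s e * θ) := by ring
        linarith
      have := hBgt (-θ) hsep
      linarith
    rcases lt_or_eq_of_le hle with hlt | heq
    · have h2 := key (-ρ') hlt
      have r1 : s (i + 1) * (-ρ') = -(s (i + 1) * ρ') := by ring
      have r2 : s o * (-ρ') = -(s o * ρ') := by ring
      linarith
    · apply noteq
      have r1 : s (i + 1) * r = -(s (i + 1) * ρ') := by rw [heq]; ring
      have r2 : s o * r = -(s o * ρ') := by rw [heq]; ring
      have r3 : s x * r = -(s x * ρ') := by rw [heq]; ring
      linarith

/-- CONTINUATION LAW, even first line with natural side on the left (`s (i+1) < s i`, i.e. `λ_i > 0`): if the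
step at row `i` moves right, row `i+1` does not step. -/
theorem away_step_terminal_even (s b : ℕ → ℝ) (i d : ℕ) (hi : Even i) (hd : Odd d) (hnat : s (i + 1) < s i)
    (hA : ∃ θ : ℝ, ∀ e o : ℕ, i ≤ e → e ≤ i + d → i ≤ o → o ≤ i + d → Even e → Odd o →
      b o + s o * θ < b e + s e * θ)
    (hB : ∃ θ : ℝ, ∀ e o : ℕ, i + 1 ≤ e → e ≤ i + d + 1 → i + 1 ≤ o → o ≤ i + d + 1 → Even e → Odd o →
      b o + s o * θ < b e + s e * θ)
    (hAB : ∀ θ : ℝ, ¬ ((∀ e o : ℕ, i ≤ e → e ≤ i + d → i ≤ o → o ≤ i + d → Even e → Odd o →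
      b o + s o * θ < b e + s e * θ) ∧ (∀ e o : ℕ, i + 1 ≤ e → e ≤ i + d + 1 → i + 1 ≤ o → o ≤ i + d + 1 →
      Even e → Odd o → b o + s o * θ < b e + s e * θ)))
    (hord : ∀ θ θ' : ℝ, (∀ e o : ℕ, i ≤ e → e ≤ i + d → i ≤ o → o ≤ i + d → Even e → Odd o →
      b o + s o * θ < b e + s e * θ) → (∀ e o : ℕ, i + 1 ≤ e → e ≤ i + d + 1 → i + 1 ≤ o → o ≤ i + d + 1 →
      Even e → Odd o → b o + s o * θ' < b e + s e * θ') → θ < θ')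
    (hB' : ∃ θ : ℝ, ∀ e o : ℕ, i + 2 ≤ e → e ≤ i + d + 2 → i + 2 ≤ o → o ≤ i + d + 2 → Even e → Odd o →
      b o + s o * θ < b e + s e * θ) :
    ∃ θ : ℝ, (∀ e o : ℕ, i + 1 ≤ e → e ≤ i + d + 1 → i + 1 ≤ o → o ≤ i + d + 1 → Even e → Odd o →
      b o + s o * θ < b e + s e * θ) ∧ (∀ e o : ℕ, i + 2 ≤ e → e ≤ i + d + 2 → i + 2 ≤ o → o ≤ i + d + 2 →
      Even e → Odd o → b o + s o * θ < b e + s e * θ) := by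
  classical
  by_contra hno
  have hBB' : ∀ θ : ℝ, ¬ ((∀ e o : ℕ, i + 1 ≤ e → e ≤ i + d + 1 → i + 1 ≤ o → o ≤ i + d + 1 → Even e →
      Odd o → b o + s o * θ < b e + s e * θ) ∧ (∀ e o : ℕ, i + 2 ≤ e → e ≤ i + d + 2 → i + 2 ≤ o →
      o ≤ i + d + 2 → Even e → Odd o → b o + s o * θ < b e + s e * θ)) := fun θ h => hno ⟨θ, h⟩
  obtain ⟨θA, hθA⟩ := hA
  obtain ⟨θB, hθB⟩ := hB
  obtain ⟨θB', hθB'⟩ := hB'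
  have hi1 : Odd (i + 1) := Even.add_one hi
  have hd1 : 1 ≤ d := by
    obtain ⟨l, hl⟩ := hd
    omega
  have hup1 : Even (i + d + 1) := by
    obtain ⟨k, hk⟩ := hi
    obtain ⟨l, hl⟩ := hd
    exact ⟨k + l + 1, by omega⟩
  have hlow2 : ¬ Even (i + d + 2) := by
    obtain ⟨k, hk⟩ := hi
    obtain ⟨l, hl⟩ := hd
    exact Nat.not_even_iff_odd.mpr ⟨k + l + 1, by omega⟩
  -- the order of `T[i+1, i+d+1]` and `T[i+2, i+d+2]`, from the step lemma with slopes at row `i+1`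
  obtain ⟨e₁, e₁', -, -, -, -, -, -, hdisj⟩ := step_slopes_odd s b (i + 1) d hi1 hd
    ⟨θB, fun e o h1 h2 h3 h4 he ho => hθB e o h1 (by omega) h3 (by omega) he ho⟩
    ⟨θB', fun e o h1 h2 h3 h4 he ho => hθB' e o (by omega) (by omega) (by omega) (by omega) he ho⟩
    (fun θ hθ => hBB' θ
      ⟨fun e o h1 h2 h3 h4 he ho => hθ.1 e o h1 (by omega) h3 (by omega) he ho,
       fun e o h1 h2 h3 h4 he ho => hθ.2 e o (by omega) (by omega) (by omega) (by omega) he ho⟩)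
  refine away_step_terminal_core (fun n => Even n) s b i d hi (Nat.not_even_iff_odd.mpr hi1) hup1 hlow2 hd1
    hnat ⟨θA, fun e o h1 h2 h3 h4 he ho => hθA e o h1 h2 h3 h4 he (Nat.not_even_iff_odd.mp ho)⟩
    ⟨θB, fun e o h1 h2 h3 h4 he ho => hθB e o h1 h2 h3 h4 he (Nat.not_even_iff_odd.mp ho)⟩
    (fun θ hθ => hAB θ
      ⟨fun e o h1 h2 h3 h4 he ho => hθ.1 e o h1 h2 h3 h4 he (Nat.not_even_iff_odd.mpr ho),
       fun e o h1 h2 h3 h4 he ho => hθ.2 e o h1 h2 h3 h4 he (Nat.not_even_iff_odd.mpr ho)⟩)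
    (fun θ θ' hθ hθ' => hord θ θ'
      (fun e o h1 h2 h3 h4 he ho => hθ e o h1 h2 h3 h4 he (Nat.not_even_iff_odd.mpr ho))
      (fun e o h1 h2 h3 h4 he ho => hθ' e o h1 h2 h3 h4 he (Nat.not_even_iff_odd.mpr ho)))
    ⟨θB', fun e o h1 h2 h3 h4 he ho => hθB' e o h1 h2 h3 h4 he (Nat.not_even_iff_odd.mp ho)⟩
    (fun θ hθ => hBB' θ
      ⟨fun e o h1 h2 h3 h4 he ho => hθ.1 e o h1 h2 h3 h4 he (Nat.not_even_iff_odd.mpr ho),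
       fun e o h1 h2 h3 h4 he ho => hθ.2 e o h1 h2 h3 h4 he (Nat.not_even_iff_odd.mpr ho)⟩) ?_
  rcases hdisj with ⟨-, -, hL⟩ | ⟨-, -, hR⟩
  · left
    intro θ θ' hθ hθ'
    exact hL θ θ'
      (fun e o h1 h2 h3 h4 he ho => hθ e o h1 (by omega) h3 (by omega) he (Nat.not_even_iff_odd.mpr ho))
      (fun e o h1 h2 h3 h4 he ho => hθ' e o (by omega) (by omega) (by omega) (by omega) he
        (Nat.not_even_iff_odd.mpr ho))
  · right
    intro θ θ' hθ hθ'
    exact hR θ θ'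
      (fun e o h1 h2 h3 h4 he ho => hθ e o h1 (by omega) h3 (by omega) he (Nat.not_even_iff_odd.mpr ho))
      (fun e o h1 h2 h3 h4 he ho => hθ' e o (by omega) (by omega) (by omega) (by omega) he
        (Nat.not_even_iff_odd.mpr ho))

/-- CONTINUATION LAW, odd first line with natural side on the left (`s i < s (i+1)`, i.e. `λ_i > 0`): if the step
at row `i` moves right, row `i+1` does not step. (Reduced to the core with the odd lines as the upper class of the
negated lines.) -/
theorem away_step_terminal_odd (s b : ℕ → ℝ) (i d : ℕ) (hi : Odd i) (hd : Odd d) (hnat : s i < s (i + 1))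
    (hA : ∃ θ : ℝ, ∀ e o : ℕ, i ≤ e → e ≤ i + d → i ≤ o → o ≤ i + d → Even e → Odd o →
      b o + s o * θ < b e + s e * θ)
    (hB : ∃ θ : ℝ, ∀ e o : ℕ, i + 1 ≤ e → e ≤ i + d + 1 → i + 1 ≤ o → o ≤ i + d + 1 → Even e → Odd o →
      b o + s o * θ < b e + s e * θ)
    (hAB : ∀ θ : ℝ, ¬ ((∀ e o : ℕ, i ≤ e → e ≤ i + d → i ≤ o → o ≤ i + d → Even e → Odd o →
      b o + s o * θ < b e + s e * θ) ∧ (∀ e o : ℕ, i + 1 ≤ e → e ≤ i + d + 1 → i + 1 ≤ o → o ≤ i + d + 1 →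
      Even e → Odd o → b o + s o * θ < b e + s e * θ)))
    (hord : ∀ θ θ' : ℝ, (∀ e o : ℕ, i ≤ e → e ≤ i + d → i ≤ o → o ≤ i + d → Even e → Odd o →
      b o + s o * θ < b e + s e * θ) → (∀ e o : ℕ, i + 1 ≤ e → e ≤ i + d + 1 → i + 1 ≤ o → o ≤ i + d + 1 →
      Even e → Odd o → b o + s o * θ' < b e + s e * θ') → θ < θ')
    (hB' : ∃ θ : ℝ, ∀ e o : ℕ, i + 2 ≤ e → e ≤ i + d + 2 → i + 2 ≤ o → o ≤ i + d + 2 → Even e → Odd o →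
      b o + s o * θ < b e + s e * θ) :
    ∃ θ : ℝ, (∀ e o : ℕ, i + 1 ≤ e → e ≤ i + d + 1 → i + 1 ≤ o → o ≤ i + d + 1 → Even e → Odd o →
      b o + s o * θ < b e + s e * θ) ∧ (∀ e o : ℕ, i + 2 ≤ e → e ≤ i + d + 2 → i + 2 ≤ o → o ≤ i + d + 2 →
      Even e → Odd o → b o + s o * θ < b e + s e * θ) := by
  classical
  by_contra hno
  have hBB' : ∀ θ : ℝ, ¬ ((∀ e o : ℕ, i + 1 ≤ e → e ≤ i + d + 1 → i + 1 ≤ o → o ≤ i + d + 1 → Even e →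
      Odd o → b o + s o * θ < b e + s e * θ) ∧ (∀ e o : ℕ, i + 2 ≤ e → e ≤ i + d + 2 → i + 2 ≤ o →
      o ≤ i + d + 2 → Even e → Odd o → b o + s o * θ < b e + s e * θ)) := fun θ h => hno ⟨θ, h⟩
  obtain ⟨θA, hθA⟩ := hA
  obtain ⟨θB, hθB⟩ := hB
  obtain ⟨θB', hθB'⟩ := hB'
  have hi1 : Even (i + 1) := Odd.add_one hi
  have hd1 : 1 ≤ d := by
    obtain ⟨l, hl⟩ := hd
    omega
  have hup1 : Odd (i + d + 1) := by
    obtain ⟨k, hk⟩ := hi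
    obtain ⟨l, hl⟩ := hd
    exact ⟨k + l + 1, by omega⟩
  have hlow2 : ¬ Odd (i + d + 2) := by
    obtain ⟨k, hk⟩ := hi
    obtain ⟨l, hl⟩ := hd
    exact Nat.not_odd_iff_even.mpr ⟨k + l + 2, by omega⟩
  -- the order of `T[i+1, i+d+1]` and `T[i+2, i+d+2]`, from the step lemma with slopes at row `i+1`
  obtain ⟨e₁, e₁', -, -, -, -, -, -, hdisj⟩ := step_slopes_even s b (i + 1) d hi1 hd
    ⟨θB, fun e o h1 h2 h3 h4 he ho => hθB e o h1 (by omega) h3 (by omega) he ho⟩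
    ⟨θB', fun e o h1 h2 h3 h4 he ho => hθB' e o (by omega) (by omega) (by omega) (by omega) he ho⟩
    (fun θ hθ => hBB' θ
      ⟨fun e o h1 h2 h3 h4 he ho => hθ.1 e o h1 (by omega) h3 (by omega) he ho,
       fun e o h1 h2 h3 h4 he ho => hθ.2 e o (by omega) (by omega) (by omega) (by omega) he ho⟩)
  -- the core, with the odd lines as the upper class of the negated lines
  refine away_step_terminal_core (fun n => Odd n) (fun t => - s t) (fun t => - b t) i d hi
    (Nat.not_odd_iff_even.mpr hi1) hup1 hlow2 hd1 (by linarith)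
    ⟨θA, fun e o h1 h2 h3 h4 he ho => by
      have := hθA o e h3 h4 h1 h2 (Nat.not_odd_iff_even.mp ho) he
      linarith⟩
    ⟨θB, fun e o h1 h2 h3 h4 he ho => by
      have := hθB o e h3 h4 h1 h2 (Nat.not_odd_iff_even.mp ho) he
      linarith⟩
    (fun θ hθ => hAB θ
      ⟨fun e o h1 h2 h3 h4 he ho => by
        have := hθ.1 o e h3 h4 h1 h2 ho (Nat.not_odd_iff_even.mpr he)
        linarith,
       fun e o h1 h2 h3 h4 he ho => by
        have := hθ.2 o e h3 h4 h1 h2 ho (Nat.not_odd_iff_even.mpr he)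
        linarith⟩)
    (fun θ θ' hθ hθ' => hord θ θ'
      (fun e o h1 h2 h3 h4 he ho => by
        have := hθ o e h3 h4 h1 h2 ho (Nat.not_odd_iff_even.mpr he)
        linarith)
      (fun e o h1 h2 h3 h4 he ho => by
        have := hθ' o e h3 h4 h1 h2 ho (Nat.not_odd_iff_even.mpr he)
        linarith))
    ⟨θB', fun e o h1 h2 h3 h4 he ho => by
      have := hθB' o e h3 h4 h1 h2 (Nat.not_odd_iff_even.mp ho) he
      linarith⟩
    (fun θ hθ => hBB' θ
      ⟨fun e o h1 h2 h3 h4 he ho => by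
        have := hθ.1 o e h3 h4 h1 h2 ho (Nat.not_odd_iff_even.mpr he)
        linarith,
       fun e o h1 h2 h3 h4 he ho => by
        have := hθ.2 o e h3 h4 h1 h2 ho (Nat.not_odd_iff_even.mpr he)
        linarith⟩) ?_
  rcases hdisj with ⟨-, -, hL⟩ | ⟨-, -, hR⟩
  · left
    intro θ θ' hθ hθ'
    exact hL θ θ'
      (fun e o h1 h2 h3 h4 he ho => by
        have := hθ o e h3 (by omega) h1 (by omega) ho (Nat.not_odd_iff_even.mpr he)
        linarith)
      (fun e o h1 h2 h3 h4 he ho => by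
        have := hθ' o e (by omega) (by omega) (by omega) (by omega) ho (Nat.not_odd_iff_even.mpr he)
        linarith)
  · right
    intro θ θ' hθ hθ'
    exact hR θ θ'
      (fun e o h1 h2 h3 h4 he ho => by
        have := hθ o e h3 (by omega) h1 (by omega) ho (Nat.not_odd_iff_even.mpr he)
        linarith)
      (fun e o h1 h2 h3 h4 he ho => by
        have := hθ' o e (by omega) (by omega) (by omega) (by omega) ho (Nat.not_odd_iff_even.mpr he)
        linarith)

end Summit.ValiantsHypothesis.ValiantsHypothesis.Theorems.KPlusLogSqLawStepTerminal
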